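import Literature.MathematicalPhysics.QuantumFieldTheory.Balaban1983to89.B6SectCTwoScaleV1Lattice
import Literature.MathematicalPhysics.QuantumFieldTheory.Balaban1983to89.B6Repr2129Positivity

/-!
# `Balaban1983to89.B6Eq2129TwoScaleV1` — T. Bałaban, *Propagators and renormalization transformations for lattice gauge
# theories. II*, Commun. Math. Phys. **96** (1984) 223–250 [Balaban1984PropagatorsII], (2.129) p. 246 and (2.119) p. 243 FOR THE
# CONCRETE TWO-SCALE LATTICE OPERATORS of the V1 multi-level torus calculus — no hypothesis beyond the fine lattice factor `c ≠ 0`,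
# the standing range `j + 1 ≤ m + K` and positive weights; and p. 239 *"R, Δ_a as in (2.17), (2.19), but only two scales are present
# now"*: the Sect. C `R`, `Δ_a`, `G` of these data ARE p21's Sect. A model operators for the two-scale family

statement-level skeleton of published theorems with citation tags; proofs where landed; nothing here is a claim about the Yang–Mills mass gap

PDF held: `paper:balaban1984-cmp96-propagators-rt-ii` (journal page = PDF page + 222); p. 246 read AS IMAGE on the ×2 render
`run/shared/lean/pub/pub-balaban/b2b-balaban-ref1/pages/1984-cmp96-propagators-rt-II/…-p024-x2.png` (2026-08-21).
CITATION HEADER (lean-in-tree rule).  WHAT IS REPRODUCED: lit-balaban SKELETON rows **B6.Eq2.129** and **B6.Eq2.119** as a MODEL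
INSTANCE: `…B6Repr2129Positivity.eq2129_of_pos` / `eq2129_printed_of_pos` / `eq2119_of_pos` (same seat: (2.129)/(2.119) from the
Gaussian representation (2.95) with every operator of Sect. C constructed, under `IsLattice` + `Positive`) APPLIED to the concrete data
`…B6SectCTwoScaleV1Lattice.tsV1` (fine torus `T^{(0)}`, unit lattice `T^{(j)}`, `Λ′ ⊂ T^{(j+1)}`, `Q_j = bondAvgIter j`, `Q′_j =
siteAvgIter j`, `∂`, `∂*`, `Δ`, `∂₁`, the admissible `ω`, `H′_j` (2.101), the block axial gauge, `Q″`, `a`), whose `isLattice` and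
`positive` discharge the two hypotheses; and the p. 239 identification of the Sect. C operators with the Sect. A ones (2.17)/(2.19)
for the two-scale family, against p21's `…B6SectAOperatorsV1.RE` / `…B6SectAVectorModelV1.deltaAE` / `GE` (imported by name).
PHASE-2 seat p22 (gen 8); owner r03, referee ref-4.  Nothing is restated.

PRINT (verbatim).  p. 239: *"On this torus we define operators R, Δ_a as in (2.17), (2.19), but only two scales are present now.
… and we take Q′*aQ′, Q*aQ equal to Q′*_{j+1}a_{j+1}Q′_{j+1}, Q*_{j+1}aQ_{j+1} on B^j(Λ), and to Q′_j*a_jQ′_j, Q_j*aQ_j on T_□∖B^j(Λ)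
… G_□ = (Δ − ∂P_□∂* + Q*aQ)⁻¹. (2.90)"*; p. 246: *"we get finally the equality ⟨J,GJ⟩ = ⟨J,∂H′_jC^{(j)}_ΛH′_j*∂*J⟩ + ⟨(J − ∂ΔH′_jC^{(j)}_ΛH′_j*∂*J),
(G̃_j + H_jC̃^{(j)}_ΛH_j*)(J − ∂ΔH′_jC^{(j)}_ΛH′_j*∂*J)⟩. (2.129) … H_j = G_jQ_j*(Q_jG_jQ_j*)⁻¹, (2.130) G̃_j = G_j −
G_jQ_j*(Q_jG_jQ_j*)⁻¹Q_jG_j (2.131)"*.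

CONTENTS (0 sorry; standard axioms).  §1 `eq2129_V1` ((2.129) for `tsV1`), `eq2129_printed_V1` (with (2.130)/(2.131) written
out), `eq2119_V1` ((2.119), Lebesgue measures on the axial `B` and on `{Q_jA = 0}`), and the positivity of `Δ_a` / `G = Δ_a⁻¹` for
the concrete operators (`deltaA_pos_V1`, `deltaA_comp_G_V1`).  §2 (p. 239): the embedding `toBondIdx : 𝔅 = Λ^c ∪ Λ′ → BondIdx
(twoScale j hj Λ′)` is a bijection (`toBondIdx_bijective`), `Q = Q″Q_j` along it (`QE_toBondIdx`), `N(Q′)` agrees (`NQ_eq`), hence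
**`R_eq`** (`R` (2.17)), **`deltaA_eq_deltaAE`** ((2.19): `Δ − ∂P∂* + Q*aQ` of Sect. C `=` p21's `∂*∂ + ∂R∂* + Q*aQ` with the printed
weights `a`, `aL^{d−2}` — `wPrinted`/`wLevel`), **`G_eq_GE`** ((2.22)/(2.90)).  HONEST SCOPE: as parts 1–2 (`…B6SectCTwoScaleV1`, `…Lattice`): ℓ²
pairings, centred blocks, `G_j` with weight `1`, `H′_j` extended to constants; the representation (2.95) ⇒ (2.129) chain is the
abstract one of this seat (`…B6Eq2112`, `…B6Eq2112Assembly`, `…B6Eq2112Lebesgue`, `…B6Repr2129Positivity`); NOT summit progress.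
Unit `lit-balaban-p22` (gen 8), HOME `run/shared/lean/pub/lit-balaban/`, 2026-08-21.
-/

noncomputable section

open MeasureTheory
open scoped InnerProductSpace

namespace Literature.MathematicalPhysics.QuantumFieldTheory.Balaban1983to89.B6Eq2129TwoScaleV1

open B6SectADomainsV1 B6SectAOperatorsV1 B6SectAVectorModelV1 B6SectCOperators B6SectCOperators.TwoScaleData B6SectCTwoScaleV1
  B6SectCTwoScaleV1Lattice LatticeFieldCalculus
open BalabanImbrieJaffe1984to88.BIJ85AxialPropagator411 (BondSpace)

variable {P : Params} {c : ℝ} (hc : c ≠ 0) {j : ℕ} (hj : j + 1 ≤ P.m + P.K) (Λ' : Finset (Site P (j + 1)))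
  {w : CIdx j Λ' → ℝ} (hw : ∀ i, 0 < w i)

include hj hw

/-- **`Δ_a > 0` for the concrete two-scale operators** (p. 226 *"the operator Δ_a is bounded from below by a positive constant"*, here
qualitative: `⟨A, Δ_aA⟩ > 0` for `A ≠ 0`). [cite: Balaban1984PropagatorsII, (2.19)–(2.22) p.226] -/
theorem deltaA_pos_V1 (v : BondSpace P) (hv : v ≠ 0) : 0 < ⟪v, (tsV1 hc Λ' w).deltaA v⟫_ℝ :=
  B6SectCPositivity.deltaA_pos (isLattice Λ' hc hj hw) (positive Λ' hc hj w) v hv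

/-- `Δ_aG = I` for the concrete `G = Δ_a⁻¹` (2.22). [cite: Balaban1984PropagatorsII, (2.22) p.226] -/
theorem deltaA_comp_G_V1 : (tsV1 hc Λ' w).deltaA ∘ₗ (tsV1 hc Λ' w).G = LinearMap.id :=
  B6SectCPositivity.deltaA_comp_G (isLattice Λ' hc hj hw) (positive Λ' hc hj w)

/-- **(2.129) p. 246 FOR THE CONCRETE TWO-SCALE LATTICE OPERATORS**: with `D = tsV1 hc Λ′ w` — `G = Δ_a⁻¹`, `K1 = ∂H′_jC^{(j)}_ΛH′_j*∂*`,
`K2 = ∂ΔH′_jC^{(j)}_ΛH′_j*∂*`, `G̃_j` the covariance (2.131), `H_j` (2.130), `C̃^{(j)}_Λ` — *"⟨J,GJ⟩ = ⟨J,∂H′_jC^{(j)}_ΛH′_j*∂*J⟩ +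
⟨(J − ∂ΔH′_jC^{(j)}_ΛH′_j*∂*J), (G̃_j + H_jC̃^{(j)}_ΛH_j*)(J − ∂ΔH′_jC^{(j)}_ΛH′_j*∂*J)⟩"*; hypotheses: `c ≠ 0`, `j + 1 ≤ m + K`,
`w > 0` only. [cite: Balaban1984PropagatorsII, (2.129) p.246] -/
theorem eq2129_V1 (J : BondSpace P) :
    ⟪J, (tsV1 hc Λ' w).G J⟫_ℝ = ⟪J, (tsV1 hc Λ' w).K1 J⟫_ℝ +
      ⟪J - (tsV1 hc Λ' w).K2 J, ((tsV1 hc Λ' w).Gt + (tsV1 hc Λ' w).Hj ∘ₗ (tsV1 hc Λ' w).Ct ∘ₗ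
        LinearMap.adjoint (tsV1 hc Λ' w).Hj) (J - (tsV1 hc Λ' w).K2 J)⟫_ℝ :=
  B6Repr2129Positivity.eq2129_of_pos (isLattice Λ' hc hj hw) (positive Λ' hc hj w) J

/-- **(2.129) with (2.130)/(2.131) written out** for the concrete operators: `H_j = …B6SectA.hOp G_j Q_j* (Q_jG_jQ_j*)⁻¹`, `G̃_j =
…B6SectA.tildeOp G_j Q_j Q_j* (Q_jG_jQ_j*)⁻¹`. [cite: Balaban1984PropagatorsII, (2.129)–(2.131) p.246] -/
theorem eq2129_printed_V1 (J : BondSpace P) :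
    ⟪J, (tsV1 hc Λ' w).G J⟫_ℝ = ⟪J, (tsV1 hc Λ' w).K1 J⟫_ℝ + ⟪J - (tsV1 hc Λ' w).K2 J,
      (B6SectA.tildeOp (tsV1 hc Λ' w).Gj (tsV1 hc Λ' w).Qv (LinearMap.adjoint (tsV1 hc Λ' w).Qv) (tsV1 hc Λ' w).Ej +
        B6SectA.hOp (tsV1 hc Λ' w).Gj (LinearMap.adjoint (tsV1 hc Λ' w).Qv) (tsV1 hc Λ' w).Ej ∘ₗ (tsV1 hc Λ' w).Ct ∘ₗ
          LinearMap.adjoint (B6SectA.hOp (tsV1 hc Λ' w).Gj (LinearMap.adjoint (tsV1 hc Λ' w).Qv) (tsV1 hc Λ' w).Ej))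
        (J - (tsV1 hc Λ' w).K2 J)⟫_ℝ :=
  B6Repr2129Positivity.eq2129_printed_of_pos (isLattice Λ' hc hj hw) (positive Λ' hc hj w) J

/-- **(2.119) p. 243 FOR THE CONCRETE TWO-SCALE LATTICE OPERATORS**, for any Lebesgue measures `dB` on the axial `B` and `dA↾{Q_jA = 0}`,
with its normalisation `Z″`: *"e^{½⟨J,GJ⟩} = exp[½⟨J,∂H′_jC^{(j)}_ΛH′_j*∂*J⟩ + ½⟨J − ∂ΔH′_jC^{(j)}_ΛH′_j*∂*J, G̃_j(J − …)⟩] · Z″⁻¹∫dB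
Π_{y∈Λ′}δ_{Ax(y)}(B) exp[−½⟨Q″B,aQ″B⟩ − ½⟨B,Δ_jB⟩ + ⟨B, H_j*(J − ∂ΔH′_jC^{(j)}_ΛH′_j*∂*J)⟩] (2.119)"*.
[cite: Balaban1984PropagatorsII, (2.119) p.243] -/
theorem eq2119_V1 (νB : Measure ↥(tsV1 hc Λ' w).Ax) [νB.IsAddHaarMeasure] (μN : Measure ↥(tsV1 hc Λ' w).NA)
    [μN.IsAddHaarMeasure] :
    ∃ Zpp : ℝ, ∀ J : BondSpace P,
      Real.exp ((1 / 2) * ⟪J, (tsV1 hc Λ' w).G J⟫_ℝ) =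
        Real.exp ((1 / 2) * ⟪J, (tsV1 hc Λ' w).K1 J⟫_ℝ +
            (1 / 2) * ⟪J - (tsV1 hc Λ' w).K2 J, (tsV1 hc Λ' w).Gt (J - (tsV1 hc Λ' w).K2 J)⟫_ℝ) * Zpp *
          ∫ m, Real.exp (-(1 / 2) * ⟪(tsV1 hc Λ' w).Qpp (m : UBond P j), (tsV1 hc Λ' w).a ((tsV1 hc Λ' w).Qpp (m : UBond P j))⟫_ℝ
            - (1 / 2) * ⟪(m : UBond P j), (tsV1 hc Λ' w).Δj (m : UBond P j)⟫_ℝ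
            + ⟪(m : UBond P j), LinearMap.adjoint (tsV1 hc Λ' w).Hj (J - (tsV1 hc Λ' w).K2 J)⟫_ℝ) ∂νB :=
  B6Repr2129Positivity.eq2119_of_pos (isLattice Λ' hc hj hw) (positive Λ' hc hj w) νB μN

/-! ## §2  p. 239: *"R, Δ_a as in (2.17), (2.19), but only two scales are present now"* — the Sect. C `Δ_a`, `G` of `tsV1` ARE
p21's Sect. A model operators `deltaAE`, `GE` for the two-scale family (printed weights) -/

section Bridge

omit hw

/-- the Sect. A index set `𝔅` of the two-scale family is `Λ^c ∪ Λ′`: the embedding of `CIdx` into p21's `BondIdx (twoScale j hj Λ′)`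
(levels `j` and `j + 1`). [cite: Balaban1984PropagatorsII, (2.3) p.224 + (2.97) p.240] -/
def toBondIdx : CIdx j Λ' → BondIdx (twoScale j hj Λ')
  | Sum.inl b => ⟨⟨⟨j, by show j < j + 1 + 1; omega⟩, b.1⟩, (twoScale.lamBond_j b.1).mpr b.2⟩
  | Sum.inr e => ⟨⟨⟨j + 1, by show j + 1 < j + 1 + 1; omega⟩, e.1⟩, (twoScale.lamBond_succ e.1).mpr e.2⟩

/-- `𝔅 = Λ^c ∪ Λ′` exactly: the embedding is a bijection (no other level carries constraints). [cite: Balaban1984PropagatorsII, (2.97) p.240] -/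
theorem toBondIdx_bijective : Function.Bijective (toBondIdx hj Λ') := by
  constructor
  · intro x y h
    rcases x with ⟨b, hb⟩ | ⟨e, he⟩ <;> rcases y with ⟨b', hb'⟩ | ⟨e', he'⟩ <;>
      simp only [toBondIdx, Subtype.mk.injEq, Sigma.mk.inj_iff, Fin.mk.injEq, heq_eq_eq] at h
    · obtain ⟨_, rfl⟩ := h
      rfl
    · omega
    · omega
    · obtain ⟨_, rfl⟩ := h
      rfl
  · rintro ⟨⟨⟨i, hi⟩, b⟩, h⟩
    by_cases hij : i = j
    · subst hij
      exact ⟨Sum.inl ⟨b, (twoScale.lamBond_j b).mp h⟩, rfl⟩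
    by_cases hij' : i = j + 1
    · subst hij'
      exact ⟨Sum.inr ⟨b, (twoScale.lamBond_succ b).mp h⟩, rfl⟩
    · exfalso
      rcases lt_or_gt_of_ne hij with hl | hg
      · exact twoScale.not_lamBond_of_lt hl b h
      · exact twoScale.not_lamBond_of_gt (show j + 1 < i by omega) b h

variable (P) in
/-- the printed weights read on p21's index set: `a` at level `j` (`Λ^c`), `aL^{d−2}` at level `j + 1` (`Λ′`). [cite: Balaban1984PropagatorsII, (2.97) p.240] -/
def wLevel (j : ℕ) (a : ℝ) {D : Domains P} (p : BondIdx D) : ℝ := if (p.1.1 : ℕ) = j then a else a * (P.L : ℝ) ^ (P.d - 2)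

/-- the weights agree along the embedding. [cite: Balaban1984PropagatorsII, (2.97) p.240] -/
theorem wLevel_toBondIdx (a : ℝ) (i : CIdx j Λ') : wLevel P j a (toBondIdx hj Λ' i) = wPrinted P j Λ' a i := by
  rcases i with b | e
  · exact if_pos rfl
  · exact if_neg (Nat.succ_ne_self j)

omit hj in
/-- the printed weights on `𝔅` are positive for `a > 0`. [cite: Balaban1984PropagatorsII, (2.97) p.240] -/
theorem wLevel_pos {a : ℝ} (ha : 0 < a) {D : Domains P} (p : BondIdx D) : 0 < wLevel P j a p := by
  unfold wLevel
  split_ifs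
  · exact ha
  · exact mul_pos ha (pow_pos (Nat.cast_pos.mpr P.L_pos) _)

/-- `Q = Q″Q_j` read along the embedding: `(QA)(ι i) = (Q″Q_jA)(i)`. [cite: Balaban1984PropagatorsII, (2.119) p.243] -/
theorem QE_toBondIdx (v : BondSpace P) (i : CIdx j Λ') :
    QE (twoScale j hj Λ') v (toBondIdx hj Λ' i) = Qpp P j Λ' (Qv P j v) i := by
  rcases i with b | e
  · rfl
  · show bondAvgIter (j + 1) (WithLp.ofLp v) e.1 = _
    rw [B5Eq120IterProof.bondAvgIter_succ]
    rfl

/-- **`N(Q′)` of the Sect. C data is `N(Q′)` (2.7)/(2.10) of the two-scale family** (p. 241 last sentence). [cite: Balaban1984PropagatorsII, (2.10) p.225 + (2.105) p.241] -/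
theorem NQ_eq : Submodule.comap (Qp P j) (admissible P j Λ') = LinearMap.ker (QpE (twoScale j hj Λ')) := by
  ext f
  rw [Submodule.mem_comap, mem_ker_QpE_iff, inGauge_iff_mem Λ' hj]

/-- **`R` of Sect. C IS `R` (2.10)/(2.17) of Sect. A for the two-scale family.** [cite: Balaban1984PropagatorsII, (2.17) p.226 + p.239] -/
theorem R_eq : (tsV1 hc Λ' w).R = RE (twoScale j hj Λ') c := by
  have key : ∀ {K K' : Submodule ℝ (ScalarSpace P)} (_ : K = K') [K.HasOrthogonalProjection] [K'.HasOrthogonalProjection],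
      (K.starProjection : ScalarSpace P →L[ℝ] ScalarSpace P) = K'.starProjection := by
    intro K K' h _ _
    subst h
    rfl
  show (((Submodule.comap (Qp P j) (admissible P j Λ')).map (lapE c)).starProjection :
      ScalarSpace P →L[ℝ] ScalarSpace P).toLinearMap =
    (((LinearMap.ker (QpE (twoScale j hj Λ'))).map (lapE c)).starProjection : ScalarSpace P →L[ℝ] ScalarSpace P).toLinearMap
  rw [key (congrArg (Submodule.map (lapE c)) (NQ_eq hj Λ'))]

/-- **p. 239 *"we define operators R, Δ_a as in (2.17), (2.19), but only two scales are present now"*: the Sect. C `Δ_a` of `tsV1`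
(second form of (2.19): `Δ − ∂P∂* + Q*aQ`, printed weights `a`, `aL^{d−2}`) IS p21's Sect. A model operator `deltaAE` (first form:
`∂*∂ + ∂R∂* + Q*aQ`) of the two-scale family.** [cite: Balaban1984PropagatorsII, (2.19) p.226 + (2.89) p.239] -/
theorem deltaA_eq_deltaAE {a : ℝ} (ha : 0 < a) :
    (tsV1 hc Λ' (wPrinted P j Λ' a)).deltaA = deltaAE (twoScale j hj Λ') c (wLevel P j a) := by
  have hL := isLattice Λ' hc hj (wPrinted_pos j Λ' ha)
  set S := (tsV1 hc Λ' (wPrinted P j Λ' a)).deltaA - deltaAE (twoScale j hj Λ') c (wLevel P j a) with hS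
  have hsym : S.IsSymmetric := fun x y => by
    rw [hS, LinearMap.sub_apply, LinearMap.sub_apply, inner_sub_left, inner_sub_right, deltaA_symm hL, inner_deltaAE_left]
  have hq : ∀ v : BondSpace P, ⟪(tsV1 hc Λ' (wPrinted P j Λ' a)).Qpp ((tsV1 hc Λ' (wPrinted P j Λ' a)).Qv v),
      (tsV1 hc Λ' (wPrinted P j Λ' a)).a ((tsV1 hc Λ' (wPrinted P j Λ' a)).Qpp ((tsV1 hc Λ' (wPrinted P j Λ' a)).Qv v))⟫_ℝ =
      ∑ p, wLevel P j a p * QE (twoScale j hj Λ') v p ^ 2 := by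
    intro v
    change ⟪Qpp P j Λ' (Qv P j v), aW P j Λ' (wPrinted P j Λ' a) (Qpp P j Λ' (Qv P j v))⟫_ℝ = _
    rw [inner_eq_sum, ← (toBondIdx_bijective hj Λ').sum_comp]
    exact Finset.sum_congr rfl fun i _ => by rw [aW_apply, wLevel_toBondIdx, QE_toBondIdx]; ring
  have h0 : ∀ v, ⟪S v, v⟫_ℝ = 0 := fun v => by
    rw [hS, LinearMap.sub_apply, inner_sub_left, deltaA_symm hL, inner_deltaAE_left, form_deltaA hL, inner_deltaAE_self, hq,
      R_eq]
    exact sub_self _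
  exact sub_eq_zero.mp (hsym.inner_map_self_eq_zero.mp h0)

/-- **… and `G = Δ_a⁻¹` (2.22)/(2.90) of Sect. C IS p21's `GE`** for the two-scale family. [cite: Balaban1984PropagatorsII, (2.22) p.226 + (2.90) p.239] -/
theorem G_eq_GE {a : ℝ} (ha : 0 < a) :
    (tsV1 hc Λ' (wPrinted P j Λ' a)).G = GE (twoScale j hj Λ') hc (w := wLevel P j a) (wLevel_pos (j := j) ha) := by
  have hL := isLattice Λ' hc hj (wPrinted_pos j Λ' ha)
  refine (B6SectCPositivity.eq_G_of_rightInverse hL (positive Λ' hc hj _) _ ?_).symm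
  rw [deltaA_eq_deltaAE hc hj Λ' ha]
  exact deltaAE_comp_GE _ hc _

end Bridge

end Literature.MathematicalPhysics.QuantumFieldTheory.Balaban1983to89.B6Eq2129TwoScaleV1

end
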